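import Summits.BirchSwinnertonDyer.BirchSwinnertonDyer.Theorems.PrintCFramBottomClassIndexLawFiveLeEisensteinEndStatePrints7
import Summits.BirchSwinnertonDyer.BirchSwinnertonDyer.Theorems.AdditiveRankOneBSDpRowKernels
import HarnessLib

/-!
# Route `PrintCFram`, crux C2 `BottomClassIndexLawFiveLe` (stmt-BirchSwinnertonDyer-20372), line `eisenstein-resource-bdp-line`:
# the END STATE of the line POINTWISE IN THE CURVE — C2's conclusion at ONE `(W, p)` from β1 and (AN) AT THAT `W`

Cell `bsd-print-cfram`, LEAD seat `bsd-line-cfram-p1` (generation g5), `--supports stmt-BirchSwinnertonDyer-20372` (helper).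
HONEST FRAMING. Nothing about BSD is proved; no stub is closed. The landed END STATEs of the line (LEAD g3/g4:
`bottomClassIndexLawFiveLe_of_prints7_of_prop14_of_flatIncl_of_analyticInequality` and its predecessors) consume the two research
stubs β1 (`stub_flatEisensteinIncl_cmRamified`) and (AN) (`stub_analyticInequality_cmRamified`) CLASS-WIDE and return the class-wide
crux. For the v6 reshape of the skeleton — C2 = [REGULAR Kriz–Li locus: print only, `…RegularLocusBSDp`] + [IRREGULAR pairs: β1 ∧ (AN)]
— the composition needs the same end state ONE CURVE AT A TIME: given `(W, p)` on the CM-ramified class with `r_an = 1`, the seven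
citations, CGLS Prop. 14, and β1/(AN) quantified over the Heegner data and frames OF THIS `W` ONLY, conclude
`RamifiedCMBottomClassIndexLawAtZp W p`. This file proves exactly that, by re-running the landed frame-level engines: the residual line
data (`lineData_cmRamified_of_prop14`), torsion + `μ = 0` (`isTorsion_and_mu_eq_zero_of_line_devissage`), the match
(`invariantMatch_of_mu_eq_zero_of_coeff_norm_lt`), the Wiles/Greenberg–Vatsal upgrade (§1, the skeleton's §2 moved to the Theorems
tree), the ROW-LOCAL kernel `bsdp_of_flatIMCEq_of_control_of_twist_row` with control (`additiveControl_heegner_of_cmRamified`) and the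
rank-zero twist (`rankZeroTwistBSDp_of_hasCM`), and k7r-c4. BSD is not proved by any of this; no summit statement is proved by this seat.

References: Castella–Grossi–Lee–Skinner 2022 Thm. 3.2.1, §3.3 [CastellaGrossiLeeSkinner2022]; Greenberg–Vatsal 2000 Thm. 1.3
[GreenbergVatsal2000]; Wiles 1990 [Wiles1990]; Jetchev–Skinner–Wan 2017 §7.4.1 [JetchevSkinnerWan2017].
-/

set_option autoImplicit false
-- the summit namespace `Summit.BirchSwinnertonDyer.BirchSwinnertonDyer` repeats the problem name by design (D-0017)
set_option linter.dupNamespace false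

noncomputable section

open scoped Classical

namespace Summit.BirchSwinnertonDyer.BirchSwinnertonDyer.Theorems.PrintCFram.EisensteinPointwise

open WeierstrassCurve NumberField IsDedekindDomain Field PowerSeries
  Literature.NumberTheory.EllipticCurves Literature.NumberTheory.EllipticCurves.GreenbergSelmer
  Literature.NumberTheory.EllipticCurves.GreenbergVatsal2000
  Literature.NumberTheory.EllipticCurves.ModularForms
  Literature.NumberTheory.EllipticCurves.Rank1Residual
  Literature.NumberTheory.EllipticCurves.Rank1Residual.Typed
  Literature.NumberTheory.EllipticCurves.IwasawaAlgebra
  Literature.NumberTheory.GaloisRepresentations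
  Literature.NumberTheory.GaloisCohomology
  Summit.BirchSwinnertonDyer.Rank1Residual
  Summit.BirchSwinnertonDyer.Rank1Residual.Additive
  Summit.BirchSwinnertonDyer.Rank1Residual.X11b Summit.BirchSwinnertonDyer.Rank1Residual.X11b.AcSelmer
  Summit.BirchSwinnertonDyer.Rank1Residual.X11b.Halves
  Summit.BirchSwinnertonDyer.Rank1Residual.X12
  Summit.BirchSwinnertonDyer.Rank1Residual.X2.ResidualDevissageModules
  Summit.BirchSwinnertonDyer.BirchSwinnertonDyer.Theses.UniversalToricDescent
  Summit.BirchSwinnertonDyer.BirchSwinnertonDyer.Theorems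
  Summit.BirchSwinnertonDyer.BirchSwinnertonDyer.Theorems.SchneiderFree
  Summit.BirchSwinnertonDyer.BirchSwinnertonDyer.Theorems.UniversalToricDescentWaldspurgerFlat
  Summit.BirchSwinnertonDyer.BirchSwinnertonDyer.Theorems.RamifiedSevenEllipticUnits
  Summit.BirchSwinnertonDyer.BirchSwinnertonDyer.Theorems.PrintCFram
  Summit.BirchSwinnertonDyer.BirchSwinnertonDyer.Theorems.PrintCFram.EisensteinResourceBdpLine

/-! ## §1 The Wiles / Greenberg–Vatsal upgrade over `𝓞_{ℂ_p}⟦T⟧` (the skeleton's §2, in the Theorems tree) -/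

section Upgrade

variable (p : ℕ) [Fact p.Prime]

/-- Non-units of `𝓞_{ℂ_p}` have norm `< 1`. [folklore] -/
theorem norm_lt_one_of_not_isUnit (x : 𝓞_ℂ_[p]) (hx : ¬ IsUnit x) : ‖(x : ℂ_[p])‖ < 1 :=
  lt_of_le_of_ne (R1.norm_coe_padicComplexInt_le_one p x)
    (fun h => hx (Literature.NumberTheory.LFunctions.Dwork.isUnit_unitBall_of_norm_eq_one h))

/-- **Divisibility + invariant match ⟹ associates** in `𝓞_{ℂ_p}⟦T⟧`: if `Q ∣ G`, the coefficients of `Q` below degree `n` are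
non-units and the degree-`n` coefficient of `G` is a unit, then `Q ~ G` (ultrametric inequality on the `n`-th coefficient of
`G = Q·h`: `h(0)` must be a unit). [cite: Wiles1990, Thm. 1.2 with §10] [cite: GreenbergVatsal2000, Thm. 1.3] -/
theorem associated_of_dvd_of_coeff_norm (Q G : PowerSeries 𝓞_ℂ_[p]) (n : ℕ) (hdiv : Q ∣ G)
    (hQ : ∀ m < n, ‖((PowerSeries.coeff m Q : 𝓞_ℂ_[p]) : ℂ_[p])‖ < 1)
    (hG : ‖((PowerSeries.coeff n G : 𝓞_ℂ_[p]) : ℂ_[p])‖ = 1) : Associated Q G := by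
  obtain ⟨h, rfl⟩ := hdiv
  by_cases hu : IsUnit (PowerSeries.constantCoeff h)
  · exact associated_mul_unit_right Q h ((PowerSeries.isUnit_iff_constantCoeff).mpr hu)
  · exfalso
    have hlt : ‖((PowerSeries.constantCoeff h : 𝓞_ℂ_[p]) : ℂ_[p])‖ < 1 := norm_lt_one_of_not_isUnit p _ hu
    have hsum : ((PowerSeries.coeff n (Q * h) : 𝓞_ℂ_[p]) : ℂ_[p]) =
        ∑ ij ∈ Finset.HasAntidiagonal.antidiagonal n,
          ((PowerSeries.coeff ij.1 Q : 𝓞_ℂ_[p]) : ℂ_[p]) * ((PowerSeries.coeff ij.2 h : 𝓞_ℂ_[p]) : ℂ_[p]) := by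
      rw [PowerSeries.coeff_mul, AddSubmonoidClass.coe_finsetSum]
      simp only [MulMemClass.coe_mul]
    have hne : (Finset.HasAntidiagonal.antidiagonal n : Finset (ℕ × ℕ)).Nonempty := ⟨(0, n), by simp⟩
    obtain ⟨ij, hij, hle⟩ := IsUltrametricDist.exists_norm_finsetSum_le_of_nonempty hne
      (fun ij : ℕ × ℕ => ((PowerSeries.coeff ij.1 Q : 𝓞_ℂ_[p]) : ℂ_[p]) * ((PowerSeries.coeff ij.2 h : 𝓞_ℂ_[p]) : ℂ_[p]))
    have hterm : ‖((PowerSeries.coeff ij.1 Q : 𝓞_ℂ_[p]) : ℂ_[p]) * ((PowerSeries.coeff ij.2 h : 𝓞_ℂ_[p]) : ℂ_[p])‖ < 1 := by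
      rw [norm_mul]
      have hi : ij.1 + ij.2 = n := Finset.HasAntidiagonal.mem_antidiagonal.mp hij
      rcases Nat.lt_or_ge ij.1 n with hlt1 | hge1
      · calc ‖((PowerSeries.coeff ij.1 Q : 𝓞_ℂ_[p]) : ℂ_[p])‖ * ‖((PowerSeries.coeff ij.2 h : 𝓞_ℂ_[p]) : ℂ_[p])‖
            ≤ ‖((PowerSeries.coeff ij.1 Q : 𝓞_ℂ_[p]) : ℂ_[p])‖ * 1 :=
              mul_le_mul_of_nonneg_left (R1.norm_coe_padicComplexInt_le_one p _) (norm_nonneg _)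
          _ < 1 := by rw [mul_one]; exact hQ _ hlt1
      · have h2 : ij.2 = 0 := by omega
        rw [h2]
        calc ‖((PowerSeries.coeff ij.1 Q : 𝓞_ℂ_[p]) : ℂ_[p])‖ * ‖((PowerSeries.coeff 0 h : 𝓞_ℂ_[p]) : ℂ_[p])‖
            ≤ 1 * ‖((PowerSeries.coeff 0 h : 𝓞_ℂ_[p]) : ℂ_[p])‖ :=
              mul_le_mul_of_nonneg_right (R1.norm_coe_padicComplexInt_le_one p _) (norm_nonneg _)
          _ < 1 := by rw [one_mul, PowerSeries.coeff_zero_eq_constantCoeff]; exact hlt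
    have : ‖((PowerSeries.coeff n (Q * h) : 𝓞_ℂ_[p]) : ℂ_[p])‖ < 1 := by
      rw [hsum]; exact lt_of_le_of_lt hle hterm
    rw [hG] at this
    exact lt_irrefl _ this

/-- **Match ⟹ reverse inclusion** (generator-free): an ideal `I ≤ (Q)` of `𝓞_{ℂ_p}⟦T⟧` containing an element with a unit coefficient in
a degree `n` below which the coefficients of `Q` are non-units contains `Q`. [cite: GreenbergVatsal2000, Thm. 1.3] -/
theorem span_le_of_le_span_of_match (I : Ideal (PowerSeries 𝓞_ℂ_[p])) (Q : PowerSeries 𝓞_ℂ_[p]) (hI : I ≤ Ideal.span {Q})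
    (hmatch : ∃ n : ℕ, (∀ m < n, ‖((PowerSeries.coeff m Q : 𝓞_ℂ_[p]) : ℂ_[p])‖ < 1) ∧
      ∃ G ∈ I, ‖((PowerSeries.coeff n G : 𝓞_ℂ_[p]) : ℂ_[p])‖ = 1) :
    Ideal.span {Q} ≤ I := by
  obtain ⟨n, hQ, G, hGI, hGn⟩ := hmatch
  have hdiv : Q ∣ G := Ideal.mem_span_singleton.mp (hI hGI)
  obtain ⟨u, hu⟩ := associated_of_dvd_of_coeff_norm p Q G n hdiv hQ hGn
  rw [Ideal.span_singleton_le_iff_mem]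
  have hQ' : Q = G * ↑u⁻¹ := by rw [← hu, mul_assoc, Units.mul_inv, mul_one]
  rw [hQ']
  exact I.mul_mem_right _ hGI

end Upgrade

/-! ## §2 The ♭-IMC equality at every frame of ONE curve, from β1 and (AN) at that curve -/

section Pointwise

variable {p : ℕ} [Fact p.Prime]

/-- **hEq at ONE curve.** For `W` CM-ramified (`p ≥ 5`) with CGLS Prop. 14 (`hfact`): if at every Heegner field / anticyclotomic frame /
♭-frame OF THIS `W` the Eisenstein inclusion β1 (under its torsion guard) and the analytic inequality (AN) hold, then the ♭-(∅,0) IMC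
EQUALITY holds at every such frame — torsion + `μ = 0` by the residual line devissage, the match by (AN), the upgrade by §1.
[cite: CastellaGrossiLeeSkinner2022, Thm. 3.2.1 and §3.3 (arXiv:2008.02571)] [cite: GreenbergVatsal2000, Thm. 1.3] -/
theorem flatIMCEq_at_of_prop14_of_flatIncl_of_analyticInequality
    (hfact : CastellaGrossiLeeSkinner2022.prop14_residualCharacterSelmer_finite)
    (W : WeierstrassCurve ℚ) [W.IsElliptic] [W.IsGloballyMinimal] (hCM : W.HasCM) (hram : CMRamified W p) (h5 : 5 ≤ p)
    (h1 : ∀ (N : ℕ) [NeZero N] (K : Type) [Field K] [NumberField K] (Dt : ModularParametrizationData W N),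
      W.conductorNorm ℤ = N → IsImaginaryQuadratic K → SatisfiesHeegnerHypothesis N K →
      ∀ (κ : ZpExtension K p), κ.IsAnticyclotomic → ∀ (γ : Field.absoluteGaloisGroup K) [Fact (κ.IsTopGenerator γ)]
        (𝔭 : HeightOneSpectrum (𝓞 K)), ((p : ℕ) : 𝓞 K) ∈ 𝔭.asIdeal → 𝔭.asIdeal.ramificationIdx (𝓞 ℚ) = 1 →
        𝔭.asIdeal.inertiaDeg (𝓞 ℚ) = 1 → ∀ (𝔭' : HeightOneSpectrum (𝓞 K)), ((p : ℕ) : 𝓞 K) ∈ 𝔭'.asIdeal → 𝔭' ≠ 𝔭 →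
        ∀ (ι' : PadicAlgCl p ≃+* ℂ), SchneiderFree.BranchInducesPrime p ι' 𝔭 →
        ∀ (ΩK : ℂ) (Ωp : ℂ_[p]) (Q : PowerSeries (PadicComplexInt p)), ΩK ≠ 0 → Ωp ≠ 0 →
          R1.IsBDPLFunctionInt p ι' 𝔭 κ γ Dt.f ΩK Ωp Q →
          Module.IsTorsion (IwasawaAlgebra p) (XAc (W.baseChange K) p κ 𝔭' ∅ γ) →
          (XAc.charIdeal (W.baseChange K) p κ 𝔭' ∅ γ).map (PowerSeries.map (R1.toCpInt p)) ≤ Ideal.span {Q})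
    (han : ∀ (N : ℕ) [NeZero N] (K : Type) [Field K] [NumberField K] (Dt : ModularParametrizationData W N),
      W.conductorNorm ℤ = N → IsImaginaryQuadratic K → SatisfiesHeegnerHypothesis N K →
      ∀ (κ : ZpExtension K p), κ.IsAnticyclotomic → ∀ (γ : Field.absoluteGaloisGroup K) [Fact (κ.IsTopGenerator γ)]
        (𝔭 : HeightOneSpectrum (𝓞 K)), ((p : ℕ) : 𝓞 K) ∈ 𝔭.asIdeal → 𝔭.asIdeal.ramificationIdx (𝓞 ℚ) = 1 →
        𝔭.asIdeal.inertiaDeg (𝓞 ℚ) = 1 → ∀ (𝔭' : HeightOneSpectrum (𝓞 K)), ((p : ℕ) : 𝓞 K) ∈ 𝔭'.asIdeal → 𝔭' ≠ 𝔭 →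
        ∀ (ι' : PadicAlgCl p ≃+* ℂ), SchneiderFree.BranchInducesPrime p ι' 𝔭 →
        ∀ (ΩK : ℂ) (Ωp : ℂ_[p]) (Q : PowerSeries (PadicComplexInt p)), ΩK ≠ 0 → Ωp ≠ 0 →
          R1.IsBDPLFunctionInt p ι' 𝔭 κ γ Dt.f ΩK Ωp Q →
          ∀ m < lambdaInvariant p (XAc (W.baseChange K) p κ 𝔭' ∅ γ),
            ‖((PowerSeries.coeff m Q : PadicComplexInt p) : ℂ_[p])‖ < 1) :
    ∀ (N : ℕ) [NeZero N] (K : Type) [Field K] [NumberField K] (Dt : ModularParametrizationData W N),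
      W.conductorNorm ℤ = N → IsImaginaryQuadratic K → SatisfiesHeegnerHypothesis N K →
      ∀ (κ : ZpExtension K p), κ.IsAnticyclotomic → ∀ (γ : Field.absoluteGaloisGroup K) [Fact (κ.IsTopGenerator γ)]
        (𝔭 : HeightOneSpectrum (𝓞 K)), ((p : ℕ) : 𝓞 K) ∈ 𝔭.asIdeal → 𝔭.asIdeal.ramificationIdx (𝓞 ℚ) = 1 →
        𝔭.asIdeal.inertiaDeg (𝓞 ℚ) = 1 → ∀ (𝔭' : HeightOneSpectrum (𝓞 K)), ((p : ℕ) : 𝓞 K) ∈ 𝔭'.asIdeal → 𝔭' ≠ 𝔭 →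
        ∀ (ι' : PadicAlgCl p ≃+* ℂ), SchneiderFree.BranchInducesPrime p ι' 𝔭 →
        ∀ (ΩK : ℂ) (Ωp : ℂ_[p]) (Q : PowerSeries (PadicComplexInt p)), ΩK ≠ 0 → Ωp ≠ 0 →
          R1.IsBDPLFunctionInt p ι' 𝔭 κ γ Dt.f ΩK Ωp Q →
          (XAc.charIdeal (W.baseChange K) p κ 𝔭' ∅ γ).map (PowerSeries.map (R1.toCpInt p)) = Ideal.span {Q} := by
  intro N _ K _ _ Dt hN hK hHN κ hκ γ _ 𝔭 h𝔭 he hf 𝔭' h𝔭' hne ι' hind ΩK Ωp Q hΩK hΩp hBDP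
  haveI : (W.baseChange K).IsElliptic := by rw [WeierstrassCurve.baseChange]; infer_instance
  -- residual line data at `𝔭'`, torsion and `μ = 0`
  obtain ⟨Φ, hfix, hΦ, hΨ⟩ := lineData_cmRamified_of_prop14 hfact p W hCM hram h5 N K hN hK hHN κ hκ 𝔭' h𝔭'
  have hdec : ¬ (decomp 𝔭' ≤ κ.kerSubgroup) :=
    ZpExtension.not_decomp_le_kerSubgroup_of_isImaginaryQuadratic hK κ (by exact_mod_cast h𝔭')
  haveI := moduleFinite_XAc_empty (W.baseChange K) κ 𝔭' γ (p := p)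
  obtain ⟨htors, hμ⟩ := isTorsion_and_mu_eq_zero_of_line_devissage (W.baseChange K) κ 𝔭' γ h𝔭' hdec
    (fun v hv hpv => by by_contra hbad; exact hv ⟨hbad, hpv⟩) Φ hfix hΦ hΨ
  -- the match from (AN), the inclusion from β1, the upgrade
  have hmatch := invariantMatch_of_mu_eq_zero_of_coeff_norm_lt (XAc (W.baseChange K) p κ 𝔭' ∅ γ) htors hμ Q
    (han N K Dt hN hK hHN κ hκ γ 𝔭 h𝔭 he hf 𝔭' h𝔭' hne ι' hind ΩK Ωp Q hΩK hΩp hBDP)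
  have hle := h1 N K Dt hN hK hHN κ hκ γ 𝔭 h𝔭 he hf 𝔭' h𝔭' hne ι' hind ΩK Ωp Q hΩK hΩp hBDP htors
  exact le_antisymm hle (span_le_of_le_span_of_match p _ Q hle hmatch)

/-- **END STATE POINTWISE: C2's conclusion at ONE `(W, p)` from the seven citations ∧ CGLS Prop. 14 ∧ β1-at-`W` ∧ (AN)-at-`W`.** For
`W/ℚ` globally minimal with CM, `p ≥ 5` CM-ramified, `r_an(W) = 1`: hEq at every frame of `W` (§2), exact control
(`additiveControl_heegner_of_cmRamified`, four of its five facts tree theorems), the rank-zero twist (`rankZeroTwistBSDp_of_hasCM`), the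
ROW-LOCAL kernel `bsdp_of_flatIMCEq_of_control_of_twist_row` ⟹ `BSDp W p` ⟹ `RamifiedCMBottomClassIndexLawAtZp W p` (k7r-c4). This is the
line's END STATE with the research stubs quantified over the data of ONE curve — the shape the v6 composition «regular ∨ irregular»
consumes. CONDITIONAL; nothing booked. [cite: CastellaGrossiLeeSkinner2022, §1.2 Prop. 14, Thm. 3.2.1 (arXiv:2008.02571)]
[cite: JetchevSkinnerWan2017, §7.4.1 (arXiv:1512.06894 p. 30)] [cite: Miller2011LMS, Def. 1.1 (arXiv:1010.2431 p. 3)] -/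
theorem ramifiedCMBottomClassIndexLawAtZp_at_of_prints7_of_prop14_of_flatIncl_of_analyticInequality
    (hprints : Hsieh2014.thmA_exists_isHsiehLFunction_unrPeriod_anyLevel ∧
      LiuZhangZhang2018.thm151_thm153_modularCurve_heegnerVector_additive ∧
      ToricPublishedInputs ∧
      (∀ (K : Type) [Field K] [NumberField K], poitouTate_sha_tateDual K) ∧
      bsdTriple_of_hasCM_of_L_one_ne_zero ∧ hasEntireLFunction_rat ∧ bsdRHS_eq_of_isIsogenous)
    (hfact : CastellaGrossiLeeSkinner2022.prop14_residualCharacterSelmer_finite)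
    (W : WeierstrassCurve ℚ) [W.IsElliptic] [W.IsGloballyMinimal] (hCM : W.HasCM) (hram : CMRamified W p) (h5 : 5 ≤ p)
    (hr : W.analyticRank = 1)
    (h1 : ∀ (N : ℕ) [NeZero N] (K : Type) [Field K] [NumberField K] (Dt : ModularParametrizationData W N),
      W.conductorNorm ℤ = N → IsImaginaryQuadratic K → SatisfiesHeegnerHypothesis N K →
      ∀ (κ : ZpExtension K p), κ.IsAnticyclotomic → ∀ (γ : Field.absoluteGaloisGroup K) [Fact (κ.IsTopGenerator γ)]
        (𝔭 : HeightOneSpectrum (𝓞 K)), ((p : ℕ) : 𝓞 K) ∈ 𝔭.asIdeal → 𝔭.asIdeal.ramificationIdx (𝓞 ℚ) = 1 →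
        𝔭.asIdeal.inertiaDeg (𝓞 ℚ) = 1 → ∀ (𝔭' : HeightOneSpectrum (𝓞 K)), ((p : ℕ) : 𝓞 K) ∈ 𝔭'.asIdeal → 𝔭' ≠ 𝔭 →
        ∀ (ι' : PadicAlgCl p ≃+* ℂ), SchneiderFree.BranchInducesPrime p ι' 𝔭 →
        ∀ (ΩK : ℂ) (Ωp : ℂ_[p]) (Q : PowerSeries (PadicComplexInt p)), ΩK ≠ 0 → Ωp ≠ 0 →
          R1.IsBDPLFunctionInt p ι' 𝔭 κ γ Dt.f ΩK Ωp Q →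
          Module.IsTorsion (IwasawaAlgebra p) (XAc (W.baseChange K) p κ 𝔭' ∅ γ) →
          (XAc.charIdeal (W.baseChange K) p κ 𝔭' ∅ γ).map (PowerSeries.map (R1.toCpInt p)) ≤ Ideal.span {Q})
    (han : ∀ (N : ℕ) [NeZero N] (K : Type) [Field K] [NumberField K] (Dt : ModularParametrizationData W N),
      W.conductorNorm ℤ = N → IsImaginaryQuadratic K → SatisfiesHeegnerHypothesis N K →
      ∀ (κ : ZpExtension K p), κ.IsAnticyclotomic → ∀ (γ : Field.absoluteGaloisGroup K) [Fact (κ.IsTopGenerator γ)]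
        (𝔭 : HeightOneSpectrum (𝓞 K)), ((p : ℕ) : 𝓞 K) ∈ 𝔭.asIdeal → 𝔭.asIdeal.ramificationIdx (𝓞 ℚ) = 1 →
        𝔭.asIdeal.inertiaDeg (𝓞 ℚ) = 1 → ∀ (𝔭' : HeightOneSpectrum (𝓞 K)), ((p : ℕ) : 𝓞 K) ∈ 𝔭'.asIdeal → 𝔭' ≠ 𝔭 →
        ∀ (ι' : PadicAlgCl p ≃+* ℂ), SchneiderFree.BranchInducesPrime p ι' 𝔭 →
        ∀ (ΩK : ℂ) (Ωp : ℂ_[p]) (Q : PowerSeries (PadicComplexInt p)), ΩK ≠ 0 → Ωp ≠ 0 →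
          R1.IsBDPLFunctionInt p ι' 𝔭 κ γ Dt.f ΩK Ωp Q →
          ∀ m < lambdaInvariant p (XAc (W.baseChange K) p κ 𝔭' ∅ γ),
            ‖((PowerSeries.coeff m Q : PadicComplexInt p) : ℂ_[p])‖ < 1) :
    X12.O11.RamifiedCMBottomClassIndexLawAtZp W p := by
  obtain ⟨hA, hL, hF, hPT2, hBF, hmod, hCassels⟩ := hprints
  obtain ⟨hPT, hEP, hcd, hBr⟩ := EisensteinResourceBdpLine.prints_four_hold
  have hGZK : rank_eq_analyticRank_of_analyticRank_le_one := hF.2.2.1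
  have hp2 : p ≠ 2 := by omega
  have hadd : Addv W p := addv_of_cmRamified W hCM hram h5
  have hB : BSDp W p :=
    bsdp_of_flatIMCEq_of_control_of_twist_row p hp2 hA hL hF W hadd hr
      (flatIMCEq_at_of_prop14_of_flatIncl_of_analyticInequality hfact W hCM hram h5 h1 han)
      (additiveControl_heegner_of_cmRamified hPT hPT2 hEP hcd hBr W hCM hram h5)
      (rankZeroTwistBSDp_of_hasCM hBF hmod W hCM)
  exact RubinFormulaZpBsdp.ramifiedCMBottomClassIndexLawAtZp_of_bsdp hCassels hmod hGZK hr.le hB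

end Pointwise

end Summit.BirchSwinnertonDyer.BirchSwinnertonDyer.Theorems.PrintCFram.EisensteinPointwise

end
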